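import Mathlib
import Summits.NavierStokesRegularity.NavierStokesRegularity.Theorems.TypeIQuarterGateScarEnvelopeTypeIZoomDictionaryDefs
import Summits.NavierStokesRegularity.NavierStokesRegularity.Theorems.TypeIQuarterGateScarEnvelopeTypeIFatKill
import Summits.NavierStokesRegularity.NavierStokesRegularity.Theorems.TypeIQuarterGateScarEnvelopeTypeIBudgetViolators
import Summits.NavierStokesRegularity.NavierStokesRegularity.Theorems.TypeIQuarterGateScarEnvelopeTypeIOfNoTwinScarObject
import Summits.NavierStokesRegularity.NavierStokesRegularity.Theorems.TypeIQuarterGateQuarterLawTypeIGlue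
import Summits.NavierStokesRegularity.NavierStokesRegularity.Theorems.TypeIQuarterGateEnvelopeQuarterLaw
import Summits.NavierStokesRegularity.NavierStokesRegularity.Theorems.TypeIQuarterGateScarEnvelopeTypeINearOneRateDss
import Literature.Analysis.FluidPDE.AncientAxisymmetricTypeILiouville
import Summits.NavierStokesRegularity.NavierStokesRegularity.Theorems.TypeIQuarterGateScarEnvelopeTypeISatelliteTowerDefs
import Summits.NavierStokesRegularity.NavierStokesRegularity.Theorems.TypeIQuarterGateScarEnvelopeTypeISatelliteTowerObjects
import Summits.NavierStokesRegularity.NavierStokesRegularity.Theorems.TypeIQuarterGateScarEnvelopeTypeISatelliteTowerClosure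
import Summits.NavierStokesRegularity.NavierStokesRegularity.Theorems.TypeIQuarterGateScarEnvelopeTypeISatelliteTowerRooted
import Summits.NavierStokesRegularity.NavierStokesRegularity.Theorems.TypeIQuarterGateScarEnvelopeTypeISatelliteTowerCensus
import Summits.NavierStokesRegularity.NavierStokesRegularity.Theorems.TypeIQuarterGateScarEnvelopeTypeISatelliteTowerExclusions
import Summits.NavierStokesRegularity.NavierStokesRegularity.Theorems.TypeIQuarterGateScarEnvelopeTypeISatelliteTowerEnvelopeDefs
import Summits.NavierStokesRegularity.NavierStokesRegularity.Theorems.TypeIQuarterGateScarEnvelopeTypeISatelliteTowerEnvelopeTame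
import Summits.NavierStokesRegularity.NavierStokesRegularity.Theorems.TypeIQuarterGateScarEnvelopeTypeISatelliteTowerEnvelopeLeaves
import Summits.NavierStokesRegularity.NavierStokesRegularity.Theorems.TypeIQuarterGateScarEnvelopeTypeISatelliteTowerRootRateDefs
import Summits.NavierStokesRegularity.NavierStokesRegularity.Theorems.TypeIQuarterGateScarEnvelopeTypeISatelliteTowerRootMeter
import Summits.NavierStokesRegularity.NavierStokesRegularity.Theorems.TypeIQuarterGateScarEnvelopeTypeISatelliteTowerRootCensus
import Summits.NavierStokesRegularity.NavierStokesRegularity.Theorems.TypeIQuarterGateScarEnvelopeTypeISatelliteTowerRateLadder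

/-!
# Part N4–N7: the printed floor as a hypothesis, (E2) vs (E2ᵣ), the class-wide minimal singular rate and the EQUI-RATED normal form, exact minimisers

Part N4–N7 of the ROUND-34 plate: `rootRate_trap`/`rootRate_saturation` under the HYPOTHESIS `SmallRateRegularity` (Wang–Zhang 2014), `infiniteDescent_iff_infiniteRootDescent_of_noEnvelopedLeaf`, `minSingRate`, `exists_equiRated`, ★★ `equiRated_of_not_scarEnvelopeTypeI`, `EquiRated.leaf_or_sphere`, and — conditionally on `MinSingRateAttained` (OPEN) — `ExactMin.saturated`/`ExactMin.next`/`exists_exactMin_of_attained`.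

PROVENANCE: declaration texts VERBATIM from the HOME plates of the instrument seat nsreg-p3 (g24/g25, cell
`pub/ns-regularity-ideate`): `round-31/Tangent31prep.lean` v5 (sha16 `e5b8668e3a090216`; = ROUND-30 plate v10 + Part K) and,
for Part L, `round-32/Tangent32prep.lean` v6 (sha16 `6123f27718636121`); for Parts M/N, `round-34/Tangent34prep.lean`
v8 (sha16 `84f56c3bc8f4da24`; = v7 `922795f19cd5db01` + Part N);
the author cannot write under `Theorems/` (`perm.theorems-prover-only`); landed by the
LEAD-lineage prover ns-sz-p1 g5 on director-ns DIRECTOR-NS #218 (2), split into ≤ 400-line modules (the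
plate's `def`s gathered in `TypeIQuarterGateScarEnvelopeTypeIZoomDictionaryDefs`), namespace
`Summit.NavierStokesRegularity.NavierStokesRegularity.Cruxes.ScarEnvelopeTypeI.ZoomDictionary` (the plate's `NsregP3.R30P`), `E3` spelled out, one-line docstrings
added where the plate had none.  `--supports stmt-NavierStokesRegularity-23843 --as helper`.

HONEST FRAMING: dictionary / census TOOLING for the crux `TypeIQuarterGate.ScarEnvelopeTypeI` (item 23843):
equivalences and normal forms, kernel-checked; NO open statement is proved — 23843, its parent
`QuarterLawTypeI` (23726), the route and Navier–Stokes regularity are OPEN; hard core evaded: none.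
-/

-- the summit-side namespace repeats a component by design (single-conjunct summit, D-0017)
set_option linter.dupNamespace false

open MeasureTheory Set Metric Filter Topology
open scoped ENNReal

namespace Summit.NavierStokesRegularity.NavierStokesRegularity.Cruxes.ScarEnvelopeTypeI.ZoomDictionary

variable {u : ℝ → (EuclideanSpace ℝ (Fin 3)) → (EuclideanSpace ℝ (Fin 3))} {a : (EuclideanSpace ℝ (Fin 3))} {ν T : ℝ}

section Tower

open Literature.Analysis.FluidPDE
variable {U : ℝ → (EuclideanSpace ℝ (Fin 3)) → (EuclideanSpace ℝ (Fin 3))} {P : ℝ → (EuclideanSpace ℝ (Fin 3)) → ℝ} {y' : (EuclideanSpace ℝ (Fin 3))} {ν : ℝ}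
open Summit.NavierStokesRegularity.NavierStokesRegularity.Cruxes.ScarEnvelopeTypeI.ScarZoom
  (CruxHypotheses ScarViolators TwinScarObject singularAt_of_isBackwardSingularPoint
    exists_localEnergy_of_typeIBound) in

/-- ★ **η-SATURATION OF THE FAR LEVELS.**  Along an infinite root descent with limiting root rate
`m_∞`: for every `η > 0`, from some level on, EVERY point of the open unit ball of the level has local
rate `≤ m_∞ + η`, while the tight rate AT THE ROOT is `≥ m_∞` — the sup-norm Type-I constant of the
level is (up to `η`) ATTAINED at its root and nowhere exceeded on the unit ball. -/
theorem rootRate_saturation {M : ℝ} {c : ℕ → TNode}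
    (hc : ∀ k, RootObj M (c k) ∧ ¬ TameRoot (c k) ∧ RootDescends (c k) (c (k + 1))) :
    ∃ m : ℝ, m ∈ Icc 0 M ∧ Tendsto (fun k => tightRate (c k).U 0) atTop (𝓝 m) ∧
      ∀ η : ℝ, 0 < η → ∃ K : ℕ, ∀ k ≥ K,
        m ≤ tightRate (c (k + 1)).U 0 ∧ ∀ y : (EuclideanSpace ℝ (Fin 3)), ‖y‖ < 1 → RateAt (m + η) (c (k + 1)).U y := by
  obtain ⟨m, hm, hle, ht⟩ := rootRate_tendsto hc
  refine ⟨m, hm, ht, fun η hη => ?_⟩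
  obtain ⟨K, hK⟩ : ∃ K : ℕ, ∀ k ≥ K, tightRate (c k).U 0 < m + η :=
    eventually_atTop.1 (ht.eventually (gt_mem_nhds (by linarith)))
  exact ⟨K, fun k hk => ⟨hle (k + 1), fun y hy =>
    (hc k).2.2.rateAt (hc k).1.1 (hc (k + 1)).1.1
      ((towerObj_of_abTower (hc k).1.1).rateAt_of_tightRate_lt (hK k hk)) hy⟩⟩

/-! #### N5. (E2) vs (E2ᵣ): the two descents are inhabited at the same rates modulo (E1⁺) -/

/-- (E2) at rate `M` ⟹ an enveloped leaf of rate `M` (a failure of (E1⁺) at that rate) OR an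
infinite ROOT descent of rate `M`: the first level of a satellite descent is a rooted node; apply the
root dichotomy (M5) there. -/
theorem rootForm_of_infiniteDescent {M : ℝ} (h : InfiniteDescent M) :
    (∃ A : ℝ, EnvelopedLeaf M A) ∨ InfiniteRootDescent M := by
  obtain ⟨c, hc⟩ := h
  exact envelopedLeaf_or_infiniteRootDescent (hc 0).1.1.1 (hc 0).1.2

/-- (E2ᵣ) at rate `M` ⟹ an enveloped leaf of rate `M` OR an infinite SATELLITE descent of rate `M`:
level `1` of a root descent is a rooted node (M5); run the rooted census (K10) from it; a finite
branch ends at a tame node, which produces an enveloped leaf (L5). -/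
theorem descentForm_of_infiniteRootDescent {M : ℝ} (h : InfiniteRootDescent M) :
    (∃ A : ℝ, EnvelopedLeaf M A) ∨ InfiniteDescent M := by
  obtain ⟨c, hc⟩ := h
  rcases rooted_census (infiniteRootDescent_rootedNode hc 0).1 with
    ⟨c', k, -, -, hch, htame⟩ | ⟨c', -, hc'⟩
  · exact Or.inl (envelopedLeaf_of_tameNode (hch k le_rfl) htame)
  · exact Or.inr ⟨c', hc'⟩

/-- **Modulo (E1⁺) the two descents coincide rate by rate**: if no enveloped leaf exists at any rate,
then for every `M`, (E2)(M) ⟺ (E2ᵣ)(M). -/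
theorem infiniteDescent_iff_infiniteRootDescent_of_noEnvelopedLeaf
    (hE : ∀ M A : ℝ, ¬ EnvelopedLeaf M A) (M : ℝ) : InfiniteDescent M ↔ InfiniteRootDescent M :=
  ⟨fun h => (rootForm_of_infiniteDescent h).resolve_left fun ⟨A, hA⟩ => hE M A hA,
    fun h => (descentForm_of_infiniteRootDescent h).resolve_left fun ⟨A, hA⟩ => hE M A hA⟩

/-! #### N6. The CLASS-WIDE MINIMAL SINGULAR RATE and the EQUI-RATED normal form

The class `ABTower M` is closed under tangent flows (`abTower_closed`), so instead of following one
chain we may minimise the tight rate over ALL singular final-time points of ALL objects of the class: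
`minSingRate M`.  Descending ONCE at a near-minimal singular point produces an object that is
singular at `0`, has local rate `≤ minSingRate M + η` at EVERY point of its open unit ball, and — by
the very definition of the class-wide infimum — tight rate `≥ minSingRate M` at EVERY singular point;
and this EQUI-RATING is inherited by everything below it (root or satellite descents).  Under the
printed floor `minSingRate M ≥ ε`.  So the twin-scar enemy of 23843 may be assumed EQUI-RATED: all
scars in its unit ball (root AND satellites, and all scars of its whole sub-tower) carry Type-I
constant in `[m_*, m_* + η]`.  Nothing open is proved. -/

/-- The set of singular tight rates of the class is bounded below. [folklore] -/
theorem singRates_bddBelow (M : ℝ) : BddBelow (singRates M) :=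
  ⟨0, fun _ ⟨_, _, _, _, hAB, _, hr⟩ => hr ▸ tightRate_nonneg (towerObj_of_abTower hAB) _⟩

/-- The class-wide minimal singular rate is below the tight rate at any singular final-time point of an A–B object. [folklore] -/
theorem minSingRate_le {M : ℝ} {H : ℝ → (EuclideanSpace ℝ (Fin 3)) → (EuclideanSpace ℝ (Fin 3)) →L[ℝ] (EuclideanSpace ℝ (Fin 3))} (hAB : ABTower M U P H) {y : (EuclideanSpace ℝ (Fin 3))}
    (hy : ¬ RegPt U y) : minSingRate M ≤ tightRate U y :=
  csInf_le (singRates_bddBelow M) ⟨U, P, H, y, hAB, hy, rfl⟩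

/-- The minimal singular rate is nonnegative. [folklore] -/
theorem minSingRate_nonneg (M : ℝ) : 0 ≤ minSingRate M := by
  by_cases hne : (singRates M).Nonempty
  · exact le_csInf hne fun _ ⟨_, _, _, _, hAB, _, hr⟩ => hr ▸ tightRate_nonneg (towerObj_of_abTower hAB) _
  · rw [Set.not_nonempty_iff_eq_empty] at hne
    simp [minSingRate, hne]

/-- If some singular rate exists, the minimal singular rate is at most `M`. [folklore] -/
theorem minSingRate_le_of_nonempty {M : ℝ} (hne : (singRates M).Nonempty) : minSingRate M ≤ M := by
  obtain ⟨r, U, P, H, y, hAB, hy, hr⟩ := hne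
  exact (minSingRate_le hAB hy).trans ((towerObj_of_abTower hAB).tightRate_le y)

/-- Near-minimal singular points exist. -/
theorem exists_singRate_lt {M : ℝ} (hne : (singRates M).Nonempty) {η : ℝ} (hη : 0 < η) :
    ∃ (U : ℝ → (EuclideanSpace ℝ (Fin 3)) → (EuclideanSpace ℝ (Fin 3))) (P : ℝ → (EuclideanSpace ℝ (Fin 3)) → ℝ) (H : ℝ → (EuclideanSpace ℝ (Fin 3)) → (EuclideanSpace ℝ (Fin 3)) →L[ℝ] (EuclideanSpace ℝ (Fin 3))) (y : (EuclideanSpace ℝ (Fin 3))),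
      ABTower M U P H ∧ ¬ RegPt U y ∧ tightRate U y < minSingRate M + η := by
  obtain ⟨r, hr, hlt⟩ := (csInf_lt_iff (singRates_bddBelow M) hne).1
    (show sInf (singRates M) < minSingRate M + η by unfold minSingRate; linarith)
  obtain ⟨U, P, H, y, hAB, hy, rfl⟩ := hr
  exact ⟨U, P, H, y, hAB, hy, hlt⟩

/-- Under the printed floor the class-wide minimal singular rate is at least `ε`. -/
theorem le_minSingRate_of_smallRateRegularity {M ε : ℝ} (hWZ : SmallRateRegularity M ε)
    (hne : (singRates M).Nonempty) : ε ≤ minSingRate M :=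
  le_csInf hne fun _ ⟨_, _, _, _, hAB, hy, hr⟩ =>
    hr ▸ (towerObj_of_abTower hAB).le_tightRate_of_not_regPt hWZ hy

/-- An equi-rated node is a root object. [folklore] -/
theorem EquiRated.rootObj {M m η : ℝ} {n : TNode} (h : EquiRated M m η n) : RootObj M n :=
  ⟨h.1, h.2.1⟩

/-- The tight rates of all scars in the unit ball of an equi-rated object lie in `[m, m + η]`. -/
theorem EquiRated.tightRate_mem_Icc {M m η : ℝ} {n : TNode} (h : EquiRated M m η n) {y : (EuclideanSpace ℝ (Fin 3))}
    (hy : ‖y‖ < 1) (hs : ¬ RegPt n.U y) : tightRate n.U y ∈ Icc m (m + η) :=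
  ⟨h.2.2.2 y hs, tightRate_le_of_rateAt (h.2.2.1 y hy)⟩

/-- ★ **EXISTENCE OF EQUI-RATED OBJECTS AT THE MINIMAL RATE.**  If the class `ABTower M` has a
singular point at all, then for every `η > 0` it contains an object EQUI-RATED at level
`(minSingRate M, η)` — obtained by ONE descent at a near-minimal singular point. -/
theorem exists_equiRated {M : ℝ} (hne : (singRates M).Nonempty) {η : ℝ} (hη : 0 < η) :
    ∃ n : TNode, EquiRated M (minSingRate M) η n := by
  obtain ⟨U, P, H, y, hAB, hy, hlt⟩ := exists_singRate_lt hne hη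
  have hT := towerObj_of_abTower hAB
  have hrate : RateAt (minSingRate M + η) U y := hT.rateAt_of_tightRate_lt hlt
  obtain ⟨L, Ū, hŪ⟩ := exists_tangentU_of_towerObj hT y
  obtain ⟨U', P', H', hAB', hae⟩ := abTower_closed hAB hŪ
  have h0' : ¬ RegPt U' 0 := fun hr => hT.not_regPt_tangentU_zero hy hŪ
    ((regPt_iff_of_ae_eq_of_norm_lt_one hae (by simp)).2 hr)
  refine ⟨⟨U', P', H', 0⟩, hAB', h0', fun z hz => ?_, fun z hz => minSingRate_le hAB' hz⟩
  exact hT.rateAt_transport (towerObj_of_abTower hAB') hŪ hae hrate hz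

/-- Equi-rating is **inherited along root descents**. -/
theorem EquiRated.rootDescends {M η : ℝ} {n n' : TNode} (h : EquiRated M (minSingRate M) η n)
    (hn' : ABTower M n'.U n'.P n'.H) (hd : RootDescends n n') :
    EquiRated M (minSingRate M) η n' := by
  obtain ⟨hAB, h0, hrate, -⟩ := h
  obtain ⟨L, Ū, hŪ, hae, -, -⟩ := hd
  have h0' : ¬ RegPt n'.U 0 := fun hr => (towerObj_of_abTower hAB).not_regPt_tangentU_zero h0 hŪ
    ((regPt_iff_of_ae_eq_of_norm_lt_one hae (by simp)).2 hr)
  refine ⟨hn', h0', fun z hz => ?_, fun z hz => minSingRate_le hn' hz⟩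
  have h0rate : RateAt (minSingRate M + η) n.U 0 := hrate 0 (by simp)
  exact (towerObj_of_abTower hAB).rateAt_transport (towerObj_of_abTower hn') hŪ hae h0rate hz

/-- Equi-rating is **inherited along satellite descents** (the satellite lies in the unit ball). -/
theorem EquiRated.descends {M η : ℝ} {n n' : TNode} (h : EquiRated M (minSingRate M) η n)
    (hn' : ABTower M n'.U n'.P n'.H) (hy : ‖n.y‖ < 1) (hys : ¬ RegPt n.U n.y) (hd : Descends n n') :
    EquiRated M (minSingRate M) η n' := by
  obtain ⟨hAB, -, hrate, -⟩ := h
  obtain ⟨L, Ū, hŪ, hae, -⟩ := hd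
  have h0' : ¬ RegPt n'.U 0 := fun hr => (towerObj_of_abTower hAB).not_regPt_tangentU_zero hys hŪ
    ((regPt_iff_of_ae_eq_of_norm_lt_one hae (by simp)).2 hr)
  refine ⟨hn', h0', fun z hz => ?_, fun z hz => minSingRate_le hn' hz⟩
  exact (towerObj_of_abTower hAB).rateAt_transport (towerObj_of_abTower hn') hŪ hae (hrate n.y hy) hz

/-- ★★ **THE EQUI-RATED NORMAL FORM OF THE TWIN-SCAR ENEMY.**  If `ScarEnvelopeTypeI` (23843) fails,
then for some rate `M` the class has singular points, and for every `η > 0` it contains a ROOT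
OBJECT equi-rated at the class-wide minimal singular rate: every point of its open unit ball has
local Type-I constant `≤ m_* + η`, every scar of it has Type-I constant `≥ m_*`; by the two
inheritance lemmas the same holds for its whole sub-tower; and the ROUND-33 root census applies to
it (`root_census`).  Under the printed floor `m_* ≥ ε(M) > 0`
(`le_minSingRate_of_smallRateRegularity`).  Nothing open is proved. -/
theorem equiRated_of_not_scarEnvelopeTypeI
    (h : ¬ Summit.NavierStokesRegularity.NavierStokesRegularity.Theses.TypeIQuarterGate.ScarEnvelopeTypeI) :
    ∃ M : ℝ, (singRates M).Nonempty ∧ ∀ η : ℝ, 0 < η → ∃ n : TNode, EquiRated M (minSingRate M) η n := by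
  obtain ⟨M, U, P, H, e, hAB, -, h0, -, -⟩ := exists_abTower_of_not_scarEnvelopeTypeI h
  have hne : (singRates M).Nonempty := ⟨_, U, P, H, 0, hAB, h0, rfl⟩
  exact ⟨M, hne, fun η hη => exists_equiRated hne hη⟩

/-- ★ **THE EQUI-RATED ROOT DICHOTOMY** (ROUND-33's meter at an equi-rated root).  An equi-rated
object at the minimal rate yields EITHER an equi-rated ENVELOPED LEAF (its root is tame: a tangent
flow at the root is KNSS-enveloped, singular at `0`, and inherits the equi-rating), OR, for EVERY
`κ > 1`, an equi-rated object with an equi-rated SCAR ON THE SPHERE `‖z‖ = κ⁻¹` (its root is not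
tame: the sphere meter `ABTower.sphere_of_not_budgetAt`).  Neither branch is excluded. -/
theorem EquiRated.leaf_or_sphere {M η : ℝ} {n : TNode} (h : EquiRated M (minSingRate M) η n) :
    EquiRatedLeaf M (minSingRate M) η ∨
      ∀ κ : ℝ, 1 < κ → ∃ n' : TNode, EquiRated M (minSingRate M) η n' ∧ ‖n'.y‖ = κ⁻¹ ∧
        ¬ RegPt n'.U n'.y ∧ tightRate n'.U n'.y ∈ Icc (minSingRate M) (minSingRate M + η) := by
  obtain ⟨hAB, h0, hrate, -⟩ := h
  have hT : TowerObj M n.U n.P := towerObj_of_abTower hAB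
  have h0rate : RateAt (minSingRate M + η) n.U 0 := hrate 0 (by simp)
  by_cases hb : BudgetAt 1 0 n.U 0
  · left
    obtain ⟨A, δ, hδ, henv⟩ := hT.envelope_of_budgetAt hb
    obtain ⟨L, Ū, hŪ⟩ := exists_tangentU_of_towerObj hT 0
    obtain ⟨U', P', H', hAB', hdec, hae⟩ := abTower_closed_decay hAB hŪ hδ henv
    have h0' : ¬ RegPt U' 0 := fun hr => hT.not_regPt_tangentU_zero h0 hŪ
      ((regPt_iff_of_ae_eq_of_norm_lt_one hae (by simp)).2 hr)
    refine ⟨⟨U', P', H', 0⟩, A, ⟨hAB', h0', fun z hz => ?_, fun z hz => minSingRate_le hAB' hz⟩, hdec⟩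
    exact hT.rateAt_transport (towerObj_of_abTower hAB') hŪ hae h0rate hz
  · right
    intro κ hκ
    obtain ⟨L, Ū, hŪ, z, hz, hreg⟩ := hAB.sphere_of_not_budgetAt hb hκ
    obtain ⟨hz0, hz1⟩ := sphere_aux hκ hz
    obtain ⟨U', P', H', hAB', hae⟩ := abTower_closed hAB hŪ
    have h0' : ¬ RegPt U' 0 := fun hr => hT.not_regPt_tangentU_zero h0 hŪ
      ((regPt_iff_of_ae_eq_of_norm_lt_one hae (by simp)).2 hr)
    have hz' : ¬ RegPt U' z := fun hr => hreg ((regPt_iff_of_ae_eq_of_norm_lt_one hae hz1).2 hr)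
    have hE : EquiRated M (minSingRate M) η ⟨U', P', H', z⟩ :=
      ⟨hAB', h0', fun w hw => hT.rateAt_transport (towerObj_of_abTower hAB') hŪ hae h0rate hw,
        fun w hw => minSingRate_le hAB' hw⟩
    exact ⟨⟨U', P', H', z⟩, hE, hz, hz', hE.tightRate_mem_Icc hz1 hz'⟩

/-- The same dichotomy from the failure of 23843: for some `M` and every `η > 0`, an equi-rated
enveloped leaf OR equi-rated sphere scars of every radius `κ⁻¹ < 1`.  Nothing open is proved. -/
theorem equiRatedLeaf_or_sphere_of_not_scarEnvelopeTypeI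
    (h : ¬ Summit.NavierStokesRegularity.NavierStokesRegularity.Theses.TypeIQuarterGate.ScarEnvelopeTypeI) :
    ∃ M : ℝ, ∀ η : ℝ, 0 < η →
      EquiRatedLeaf M (minSingRate M) η ∨
        ∀ κ : ℝ, 1 < κ → ∃ n' : TNode, EquiRated M (minSingRate M) η n' ∧ ‖n'.y‖ = κ⁻¹ ∧
          ¬ RegPt n'.U n'.y ∧ tightRate n'.U n'.y ∈ Icc (minSingRate M) (minSingRate M + η) := by
  obtain ⟨M, hne, hη⟩ := equiRated_of_not_scarEnvelopeTypeI h
  exact ⟨M, fun η hη0 => by obtain ⟨n, hn⟩ := hη η hη0; exact hn.leaf_or_sphere⟩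

/-! #### N7. Below an EXACT minimiser everything is EXACTLY saturated (conditional normal form)

The `η = 0` object — a scar whose tight rate EQUALS the class-wide minimum — is NOT constructed here
(it needs weak-* compactness of A–B's class for general sequences + persistence of singularities,
A–B 2019 Prop. 2.3, print not tree).  But IF it exists, every tangent flow at its root is EXACTLY
SATURATED: scaled speed `√(−t)‖U'‖ ≤ m_*` at EVERY point of every `Q_R(0)`, `R < 1`, and Type-I
constant EXACTLY `m_*` at every scar of the open unit ball (root included).  This is the typed target
of R35-α. -/

/-- ★ **EXACT SATURATION BELOW AN EXACT MINIMISER.** -/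
theorem ExactMin.saturated {M : ℝ} {n : TNode} (h : ExactMin M n) {L : ℕ → ℝ} {Ū : ℝ → (EuclideanSpace ℝ (Fin 3)) → (EuclideanSpace ℝ (Fin 3))}
    (hŪ : TangentU n.U n.P 0 0 L Ū) {U' : ℝ → (EuclideanSpace ℝ (Fin 3)) → (EuclideanSpace ℝ (Fin 3))} {P' : ℝ → (EuclideanSpace ℝ (Fin 3)) → ℝ}
    {H' : ℝ → (EuclideanSpace ℝ (Fin 3)) → (EuclideanSpace ℝ (Fin 3)) →L[ℝ] (EuclideanSpace ℝ (Fin 3))} (hAB' : ABTower M U' P' H')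
    (hae : ∀ R ∈ Ioo (0 : ℝ) 1, ∀ᵐ z ∂(volume.restrict (parabolicCylinder R (0 : ℝ × (EuclideanSpace ℝ (Fin 3))))),
      Ū z.1 z.2 = U' z.1 z.2) :
    ¬ RegPt U' 0 ∧
      (∀ R ∈ Ioo (0 : ℝ) 1, ∀ t ∈ Ioo (-(R ^ 2)) 0, ∀ x ∈ ball (0 : (EuclideanSpace ℝ (Fin 3))) R,
        Real.sqrt (-t) * ‖U' t x‖ ≤ minSingRate M) ∧
      ∀ y : (EuclideanSpace ℝ (Fin 3)), ‖y‖ < 1 → ¬ RegPt U' y → tightRate U' y = minSingRate M := by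
  obtain ⟨hAB, h0, hmin⟩ := h
  have hT : TowerObj M n.U n.P := towerObj_of_abTower hAB
  have hT' : TowerObj M U' P' := towerObj_of_abTower hAB'
  have hrate : ∀ η : ℝ, 0 < η → RateAt (minSingRate M + η) n.U 0 := fun η hη =>
    hT.rateAt_of_tightRate_lt (by rw [hmin]; linarith)
  have h0' : ¬ RegPt U' 0 := fun hr => hT.not_regPt_tangentU_zero h0 hŪ
    ((regPt_iff_of_ae_eq_of_norm_lt_one hae (by simp)).2 hr)
  refine ⟨h0', fun R hR t ht x hx => ?_, fun y hy hs => ?_⟩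
  · refine le_of_forall_pos_le_add fun η hη => ?_
    exact hT.rate_transport hT' hŪ hae (hrate η hη) hR t ht x hx
  · refine le_antisymm (le_of_forall_pos_le_add fun η hη => ?_) (minSingRate_le hAB' hs)
    exact tightRate_le_of_rateAt (hT.rateAt_transport hT' hŪ hae (hrate η hη) hy)

/-- Below an exact minimiser the next level (any tangent flow at the root, in its class
representative) is again an exact minimiser AND equi-rated at level `(m_*, η)` for EVERY `η > 0`. -/
theorem ExactMin.next {M : ℝ} {n : TNode} (h : ExactMin M n) {L : ℕ → ℝ} {Ū : ℝ → (EuclideanSpace ℝ (Fin 3)) → (EuclideanSpace ℝ (Fin 3))}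
    (hŪ : TangentU n.U n.P 0 0 L Ū) {U' : ℝ → (EuclideanSpace ℝ (Fin 3)) → (EuclideanSpace ℝ (Fin 3))} {P' : ℝ → (EuclideanSpace ℝ (Fin 3)) → ℝ}
    {H' : ℝ → (EuclideanSpace ℝ (Fin 3)) → (EuclideanSpace ℝ (Fin 3)) →L[ℝ] (EuclideanSpace ℝ (Fin 3))} (hAB' : ABTower M U' P' H')
    (hae : ∀ R ∈ Ioo (0 : ℝ) 1, ∀ᵐ z ∂(volume.restrict (parabolicCylinder R (0 : ℝ × (EuclideanSpace ℝ (Fin 3))))),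
      Ū z.1 z.2 = U' z.1 z.2) (y : (EuclideanSpace ℝ (Fin 3))) :
    ExactMin M ⟨U', P', H', y⟩ ∧ ∀ η : ℝ, 0 < η → EquiRated M (minSingRate M) η ⟨U', P', H', y⟩ := by
  obtain ⟨h0', hsat, hscar⟩ := h.saturated hŪ hAB' hae
  refine ⟨⟨hAB', h0', hscar 0 (by simp) h0'⟩, fun η hη => ⟨hAB', h0', fun z hz => ?_,
    fun z hz => minSingRate_le hAB' hz⟩⟩
  obtain ⟨hAB, h0, hmin⟩ := h
  have hT : TowerObj M n.U n.P := towerObj_of_abTower hAB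
  exact hT.rateAt_transport (towerObj_of_abTower hAB') hŪ hae
    (hT.rateAt_of_tightRate_lt (by rw [hmin]; linarith)) hz

/-- If the minimal singular rate is attained, an exact minimiser node exists. [folklore] -/
theorem exists_exactMin_of_attained {M : ℝ} (h : MinSingRateAttained M) : ∃ n : TNode, ExactMin M n := by
  obtain ⟨U, P, H, y, hAB, hy, hr⟩ := h
  -- move the scar to the root by one descent? No: an exact minimiser needs the scar AT 0 with the
  -- same tight rate; descending may only LOWER the tight rate (which is already minimal), so the
  -- next level at the scar is again minimal: use transport + the class infimum.
  have hT : TowerObj M U P := towerObj_of_abTower hAB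
  obtain ⟨L, Ū, hŪ⟩ := exists_tangentU_of_towerObj hT y
  obtain ⟨U', P', H', hAB', hae⟩ := abTower_closed hAB hŪ
  have h0' : ¬ RegPt U' 0 := fun hr' => hT.not_regPt_tangentU_zero hy hŪ
    ((regPt_iff_of_ae_eq_of_norm_lt_one hae (by simp)).2 hr')
  refine ⟨⟨U', P', H', 0⟩, hAB', h0', le_antisymm (le_of_forall_pos_le_add fun η hη => ?_)
    (minSingRate_le hAB' h0')⟩
  have hrate : RateAt (minSingRate M + η) U y := hT.rateAt_of_tightRate_lt (by rw [← hr]; linarith)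
  exact tightRate_le_of_rateAt (hT.rateAt_transport (towerObj_of_abTower hAB') hŪ hae hrate (by simp))

end Tower

end Summit.NavierStokesRegularity.NavierStokesRegularity.Cruxes.ScarEnvelopeTypeI.ZoomDictionary
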